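import Literature.NumberTheory.EllipticCurves.BhargavaShankarCounting
import Literature.MeasureTheory.Group.PadicIntHaar
import Mathlib.MeasureTheory.Integral.Bochner.Basic
import Mathlib.NumberTheory.Padics.PadicNorm
import HarnessLib

/-!
# Bhargava–Shankar, eq. (31): the local masses `M_p(V,F)`, `M_p(U₁,F)` and the sieve step
# `N(S^F; 2¹²X) = N(V_ℤ^{(0)} ∪ V_ℤ^{(2+)} ∪ V_ℤ^{(1)}; 2¹²X) · ∏_p |2¹⁰/3³|_p M_p(V,F) + o(X^{5/6})`
# vendored as a named fact (finer decomposition of `bhargavaShankar_sum_irredClassCount_asymptotic`)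

Topic `Literature/NumberTheory/EllipticCurves`. Fourth file of the decomposition of the named fact
`Literature.NumberTheory.EllipticCurves.averageRankLE_three_halves` (`BSDWave0.lean`, Cor. 1.2 of
the source), refining the input "eq. (31)" =
`Literature.NumberTheory.EllipticCurves.bhargavaShankar_sum_irredClassCount_asymptotic` of
`BhargavaShankarCounting.lean`.

Source: M. Bhargava, A. Shankar, *Binary quartic forms having bounded invariants, and the
boundedness of the average rank of elliptic curves*, Ann. of Math. (2) 181 (2015) 191–242,
doi:10.4007/annals.2015.181.1.3. **Numbering caveat** (as in `BinaryQuarticForms.lean`): section,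
equation and theorem numbers are those of the held arXiv text `arXiv:1006.1002v2`, whose §5 is
"The mean size of the `2`-Selmer group of elliptic curves" (§3 of the published version).

## The printed derivation of eq. (31) (§5.4, proof of Theorem 5.14, p. 34 of the held text)

For a large family `F` (here: all elliptic curves `E_{A,B}`, `p⁴ ∤ A` or `p⁶ ∤ B`) write
`F^{inv} = {(I(E), J(E)) : E ∈ F}` (`I = −3A`, `J = −27B`, §5 p. 31), `F_p^{inv}` for its
`p`-adic closure in `ℤ_p × ℤ_p`, and `E_{I,J}` for "the elliptic curve having invariants `I` and
`J`" (p. 31), i.e. `y² = x³ − (I/3)x − J/27`. The text reads: "the numerator of the left hand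
side of [Thm 5.14] is equal to `N(S^F; 2¹²X)`, the number of `PGL₂(ℚ)`-equivalence classes of
locally soluble irreducible integral binary quartic forms having invariants `2⁴I` and `2⁶J`, such
that `(I,J) ∈ F^{inv}` and `H(2⁴I, 2⁶J) < 2¹²X`. By Propositions 5.12 and 5.13 we have, up to an
error of `o(X^{5/6})`, that

  `N(S^F; 2¹²X) = N(V_ℤ^{(0)} ∪ V_ℤ^{(2+)} ∪ V_ℤ^{(1)}; 2¹²X) · ∏_p μ_p(S^F)`
  `            = N(V_ℤ^{(0)} ∪ V_ℤ^{(2+)} ∪ V_ℤ^{(1)}; 2¹²X) · ∏_p |2¹⁰/3³|_p · M_p(V,F)`      (†)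
  `            = (2/27) ζ(2) 2¹⁰ [(1/4+1/4)·Vol(R₁⁺) + (1/2)·Vol(R₁⁻)] · ∏_p |2¹⁰/3³|_p · M_p(V,F) · X^{5/6}`
  `            = ζ(2) [Vol(R₁⁺) + Vol(R₁⁻)] · ∏_p M_p(V,F) · X^{5/6};`                        (31)

the proof is again identical to that of Theorem (mcc)" [the sieve of §3.7, built on Thm 2.11, the
congruence version of Thm 2.1]. Here (Prop. 5.12)
`M_p(V,F) := (1 − p⁻²) ∫_{(I,J) ∈ F_p^{inv}} Σ_{σ ∈ E_{I,J}(ℚ_p)/2E_{I,J}(ℚ_p)} 1/#E_{I,J}[2](ℚ_p) dI dJ`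
and (eq. (28)) `M_p(U₁,F) := ∫_{F_p^{inv}} dI dJ`, "where the measure `dI dJ` is normalized so that
`ℤ_p × ℤ_p` has measure `1`"; `N(S; X)` is the number of `GL₂(ℤ)`-classes of irreducible
`f ∈ S` with `H(f) < X` (Thm 2.1) and `V_ℤ^{(2+)}` the positive definite integral forms (§2.1).

**What is vendored here.** Line (†) — the sieve from `GL₂(ℤ)`-classes of all irreducible forms to
`PGL₂(ℚ)`-classes of locally soluble forms with invariants in `2⁴F^{inv} × 2⁶F^{inv}`, with the
`p`-adic densities of Prop. 5.12 and the uniformity estimate Prop. 5.13 — as the named fact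
`bhargavaShankar_locSolIrredClassCount_asymptotic`, for the family of all elliptic curves. This is
the part of the argument resting on §2.5 (Thm 2.11), §5.2 (Prop. 5.12, a `p`-adic Jacobian
computation) and §5.3 (Prop. 5.13 ⇐ the uniformity estimate of §4); its statement needs only the
local masses, defined below verbatim. The remaining two lines of (31) use Thm 2.1
(`bhargavaShankar_classCount`, vendored in `BinaryQuarticForms.lean`; `Vol(R₁⁺) = 8/5`,
`Vol(R₁⁻) = 32/5`, Prop. 2.10) and the product formula, and the evaluation
`ζ(2) ∏_p M_p(V,F)/M_p(U₁,F) = 2` uses Lemma 5.16 (Brumer–Kramer,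
`brumerKramer_card_quotient_two`); that assembly — (†) + Thm 2.1 + Lemma 5.16 + Lemma 5.15 ⇒
eq. (31) in the tree's normalisation (`bhargavaShankar_sum_irredClassCount_asymptotic`) — is the
business of the companion `Proofs` files, together with the computation of `F_p^{inv}` and of
`M_p(U₁,F) = |3⁴|_p (1 − p⁻¹⁰)`.

## Contents

* `BinaryQuartic.posDefinite` — `V_ℤ^{(2+)}` (§2.1).
* `curveOfInvariants K I J` — `E_{I,J} : y² = x³ − (I/3)x − J/27` (p. 31).
* `localSelmerRatio p (I,J)` — the integrand `Σ_{σ ∈ E_{I,J}(ℚ_p)/2E_{I,J}(ℚ_p)} 1/#E_{I,J}[2](ℚ_p)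
  = #(E_{I,J}(ℚ_p)/2E_{I,J}(ℚ_p)) / #E_{I,J}(ℚ_p)[2]` (Prop. 5.12).
* `invariantPairs` — `F^{inv}` for the family of all curves; `invariantPairsAdicClosure p` —
  `F_p^{inv}`; `minimalPairsAdic p`, `invariantPairsAdic p` — its explicit description
  `{(−3A, −27B) : p⁴ ∤ A or p⁶ ∤ B}` (equality proved in the companion file).
* `localMassV p` — `M_p(V,F)`; `localMassU p` — `M_p(U₁,F)` (Prop. 5.12, eq. (28)).
* `locSolIrredClassCount Y` — `N(S^F; Y)`.
* The named fact `bhargavaShankar_locSolIrredClassCount_asymptotic` — line (†).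

## Design choices

* The `p`-adic measure is the normalised Haar measure `volume` on `ℤ_[p]`
  (`Literature/MeasureTheory/Group/PadicIntHaar.lean`), and `dI dJ` the product measure on
  `ℤ_[p] × ℤ_[p]` (total mass `1`, as printed); `∫` is the Bochner integral.
* The integrand of `M_p(V,F)` is only meaningful where `E_{I,J}` is an elliptic curve
  (`4I³ ≠ J²`); on the curve `4I³ = J²` (a set of measure `0`, companion file) it is set to `0`.
  `#(E(ℚ_p)/2E(ℚ_p))` and `#E(ℚ_p)[2]` are `Nat.card`s of Mathlib's group of affine points over
  `ℚ_p`, exactly as in `brumerKramer_card_quotient_two` (both finite: Lemma 5.16).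
* `|2¹⁰/3³|_p` is Mathlib's `padicNorm p (2¹⁰/3³)`; the product over primes is a `tprod` over
  `Nat.Primes` (its convergence, granted Lemma 5.16, is proved in the companion file).
* The fact is vendored for the family of all elliptic curves only (the case used by Thm 1.1 and
  Cor. 1.2); the source states it for every large family `F`.
-/

noncomputable section

open scoped Classical
open MeasureTheory Filter Topology

namespace Literature.NumberTheory.EllipticCurves

namespace BinaryQuartic

/-- `V_ℤ^{(2+)}`: the positive definite integral binary quartic forms, i.e. those taking only
positive values at nonzero real vectors (Bhargava–Shankar 2015, §2.1: "Let `V_ℝ^{(2+)}` (resp.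
`V_ℝ^{(2−)}`) denote the subset of `V_ℝ^{(2)}` consisting of the positive definite forms (resp.
negative definite forms) … `V_ℤ^{(i)} = V_ℝ^{(i)} ∩ V_ℤ` for `i = 2+` and `2−`").
[cite: BhargavaShankarAnnals2015, §2.1 (V^{(2+)})] -/
def posDefinite : Set (BinaryQuartic ℤ) :=
  {f | ∀ x y : ℝ, (x ≠ 0 ∨ y ≠ 0) → 0 < (f.map (Int.castRingHom ℝ)).eval x y}

/-- A positive definite form is definite: `V_ℤ^{(2+)} ⊆ V_ℤ^{(2)}`. [cite: BhargavaShankarAnnals2015, §2.1 (V^{(2+)} ⊆ V^{(2)})] -/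
theorem posDefinite_subset_noRealRoots : posDefinite ⊆ noRealRoots :=
  fun _ hf ↦ Or.inl hf

end BinaryQuartic

open BinaryQuartic

/-! ### The curve `E_{I,J}` and the local integrand -/

/-- `E_{I,J}`: "the elliptic curve having invariants equal to `I` and `J`" (Bhargava–Shankar,
held arXiv text §5, p. 31), i.e. — since `E(A,B) : y² = x³ + Ax + B` has `I = −3A`, `J = −27B` —
the Weierstrass curve `y² = x³ − (I/3)x − J/27` over a field `K` (of characteristic `≠ 3`; used
with `K = ℚ_p`). [cite: BhargavaShankarAnnals2015, §5 p. 31 (E_{I,J}; arXiv:1006.1002v2 numbering)] -/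
def curveOfInvariants (K : Type*) [Field K] (I J : K) : WeierstrassCurve K :=
  ⟨0, 0, 0, -I / 3, -J / 27⟩

/-- `E_{I(E), J(E)} = E(A,B)` for `I = −3A`, `J = −27B` (in characteristic `0`).
[cite: BhargavaShankarAnnals2015, §5 p. 31 (I(E) = −3A, J(E) = −27B)] -/
theorem curveOfInvariants_neg (K : Type*) [Field K] [CharZero K] (A B : K) :
    curveOfInvariants K (-3 * A) (-27 * B) = ⟨0, 0, 0, A, B⟩ := by
  simp only [curveOfInvariants, neg_mul, neg_neg]
  congr 1 <;> field_simp

/-- The integrand of `M_p(V,F)` at `(I,J) ∈ ℤ_p × ℤ_p` (Bhargava–Shankar, Prop. 5.12):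
`Σ_{σ ∈ E_{I,J}(ℚ_p)/2E_{I,J}(ℚ_p)} 1/#E_{I,J}[2](ℚ_p) = #(E_{I,J}(ℚ_p)/2E_{I,J}(ℚ_p)) / #E_{I,J}(ℚ_p)[2]`,
where `E_{I,J}(ℚ_p)` is Mathlib's group of affine points of `curveOfInvariants ℚ_[p] I J`,
`2E_{I,J}(ℚ_p)` the range of multiplication by `2` and `E_{I,J}(ℚ_p)[2]` the `2`-torsion subgroup
(`Nat.card`s, as in `brumerKramer_card_quotient_two`). Only meaningful when `E_{I,J}` is an
elliptic curve, i.e. `4I³ ≠ J²`; on the null curve `4I³ = J²` the value is set to `0` (junk,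
irrelevant under the integral). [cite: BhargavaShankarAnnals2015, Prop. 5.12 (integrand of M_p(V,F); arXiv:1006.1002v2 numbering)] -/
def localSelmerRatio (p : ℕ) [Fact p.Prime] (IJ : ℤ_[p] × ℤ_[p]) : ℝ :=
  if 4 * IJ.1 ^ 3 - IJ.2 ^ 2 ≠ 0 then
    (Nat.card ((curveOfInvariants ℚ_[p] (IJ.1 : ℚ_[p]) (IJ.2 : ℚ_[p])).toAffine.Point ⧸
        (zsmulAddGroupHom
          (α := (curveOfInvariants ℚ_[p] (IJ.1 : ℚ_[p]) (IJ.2 : ℚ_[p])).toAffine.Point) 2).range) : ℝ) /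
      Nat.card (AddSubgroup.torsionBy
        (curveOfInvariants ℚ_[p] (IJ.1 : ℚ_[p]) (IJ.2 : ℚ_[p])).toAffine.Point 2)
  else 0

/-- On the discriminant curve `4I³ = J²` the integrand is (by convention) `0`. [cite: BhargavaShankarAnnals2015, Prop. 5.12 (arXiv:1006.1002v2 numbering)] -/
theorem localSelmerRatio_of_eq_zero (p : ℕ) [Fact p.Prime] {IJ : ℤ_[p] × ℤ_[p]}
    (h : 4 * IJ.1 ^ 3 - IJ.2 ^ 2 = 0) : localSelmerRatio p IJ = 0 := by
  simp [localSelmerRatio, h]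

/-- The integrand is nonnegative. [cite: BhargavaShankarAnnals2015, Prop. 5.12 (arXiv:1006.1002v2 numbering)] -/
theorem localSelmerRatio_nonneg (p : ℕ) [Fact p.Prime] (IJ : ℤ_[p] × ℤ_[p]) :
    0 ≤ localSelmerRatio p IJ := by
  unfold localSelmerRatio
  split_ifs
  · positivity
  · exact le_rfl

/-! ### `F^{inv}`, its `p`-adic closure, and the local masses (family of all curves) -/

/-- `F^{inv} = {(I(E), J(E)) : E ∈ F}` for the family `F` of all elliptic curves `E_{A,B}`
(`4A³ + 27B² ≠ 0`, no prime with `p⁴ ∣ A` and `p⁶ ∣ B`; the tree's `IsInHeightFamily`), with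
`I(E) = −3A`, `J(E) = −27B` (Bhargava–Shankar, held arXiv text §5, p. 31: "If `F` is a set of
elliptic curves … we denote by `F^{inv}` the set `{(I(E),J(E)) : E ∈ F}`").
[cite: BhargavaShankarAnnals2015, §5 p. 31 (F^{inv}; arXiv:1006.1002v2 numbering)] -/
def invariantPairs : Set (ℤ × ℤ) :=
  {IJ | ∃ AB : ℤ × ℤ, IsInHeightFamily AB ∧ IJ = (-3 * AB.1, -27 * AB.2)}

/-- Membership in `F^{inv}` (unfolding). [cite: BhargavaShankarAnnals2015, §5 p. 31 (arXiv:1006.1002v2 numbering)] -/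
theorem mem_invariantPairs_iff (IJ : ℤ × ℤ) :
    IJ ∈ invariantPairs ↔ ∃ AB : ℤ × ℤ, IsInHeightFamily AB ∧ IJ = (-3 * AB.1, -27 * AB.2) :=
  Iff.rfl

/-- `F_p^{inv}`: "the `p`-adic closure of `F^{inv}` in `ℤ_p × ℤ_p`" (Bhargava–Shankar, held arXiv
text §5, p. 31), for the family of all elliptic curves: the topological closure of the image of
`invariantPairs` under `ℤ × ℤ → ℤ_p × ℤ_p`. (Described explicitly, and its measure
`|3⁴|_p (1 − p⁻¹⁰)` computed, in the companion file.) [cite: BhargavaShankarAnnals2015, §5 p. 31 (F_p^{inv}; arXiv:1006.1002v2 numbering)] -/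
def invariantPairsAdicClosure (p : ℕ) [Fact p.Prime] : Set (ℤ_[p] × ℤ_[p]) :=
  closure ((fun IJ : ℤ × ℤ ↦ ((IJ.1 : ℤ_[p]), (IJ.2 : ℤ_[p]))) '' invariantPairs)

/-- `F_p^{inv}` is closed, hence measurable. [cite: BhargavaShankarAnnals2015, §5 p. 31 (arXiv:1006.1002v2 numbering)] -/
theorem measurableSet_invariantPairsAdicClosure (p : ℕ) [Fact p.Prime] :
    MeasurableSet (invariantPairsAdicClosure p) :=
  isClosed_closure.measurableSet

/-- The pairs `(A, B) ∈ ℤ_p × ℤ_p` with `p⁴ ∤ A` or `p⁶ ∤ B` — the `p`-adic closure of the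
coefficient pairs of the family of all curves `E_{A,B}` (the "large at `p`" condition of
Bhargava–Shankar, held arXiv text §5, p. 31, for the family of all elliptic curves; its density
`1 − p⁻¹⁰` is the factor `M_p(U₁,F)` of Lemma 5.15 in `(A,B)`-coordinates, cf.
`heightFamilyConstant`). [cite: BhargavaShankarAnnals2015, §5 p. 31 and Lemma 5.15 (arXiv:1006.1002v2 numbering)] -/
def minimalPairsAdic (p : ℕ) [Fact p.Prime] : Set (ℤ_[p] × ℤ_[p]) :=
  {AB | ¬ ((p : ℤ_[p]) ^ 4 ∣ AB.1 ∧ (p : ℤ_[p]) ^ 6 ∣ AB.2)}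

/-- The explicit description of `F_p^{inv}` for the family of all elliptic curves:
`{(−3A, −27B) : (A, B) ∈ ℤ_p², p⁴ ∤ A or p⁶ ∤ B}` (equality with the closure
`invariantPairsAdicClosure p` is proved in the companion file). [cite: BhargavaShankarAnnals2015, §5 p. 31 (F_p^{inv}; arXiv:1006.1002v2 numbering)] -/
def invariantPairsAdic (p : ℕ) [Fact p.Prime] : Set (ℤ_[p] × ℤ_[p]) :=
  (fun AB : ℤ_[p] × ℤ_[p] ↦ (-3 * AB.1, -27 * AB.2)) '' minimalPairsAdic p

/-- Membership in `minimalPairsAdic` (unfolding). [cite: BhargavaShankarAnnals2015, §5 p. 31 (arXiv:1006.1002v2 numbering)] -/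
theorem mem_minimalPairsAdic_iff (p : ℕ) [Fact p.Prime] (AB : ℤ_[p] × ℤ_[p]) :
    AB ∈ minimalPairsAdic p ↔ ¬ ((p : ℤ_[p]) ^ 4 ∣ AB.1 ∧ (p : ℤ_[p]) ^ 6 ∣ AB.2) :=
  Iff.rfl

/-- Membership in `invariantPairsAdic` (unfolding). [cite: BhargavaShankarAnnals2015, §5 p. 31 (arXiv:1006.1002v2 numbering)] -/
theorem mem_invariantPairsAdic_iff (p : ℕ) [Fact p.Prime] (IJ : ℤ_[p] × ℤ_[p]) :
    IJ ∈ invariantPairsAdic p ↔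
      ∃ AB : ℤ_[p] × ℤ_[p], AB ∈ minimalPairsAdic p ∧ (-3 * AB.1, -27 * AB.2) = IJ := by
  simp only [invariantPairsAdic, Set.mem_image]

/-- **The local mass `M_p(V,F)`** of all isomorphism classes of soluble `2`-coverings of elliptic
curves over `ℚ_p` (Bhargava–Shankar, Prop. 5.12), for the family `F` of all elliptic curves:
`M_p(V,F) := (1 − 1/p²) ∫_{(I,J) ∈ F_p^{inv}} Σ_{σ ∈ E_{I,J}/2E_{I,J}} 1/#E_{I,J}[2](ℚ_p) dI dJ`,
`dI dJ` the Haar measure on `ℤ_p × ℤ_p` of total mass `1`. By Lemma 5.16 (Brumer–Kramer) the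
integrand is `1` (`p ≠ 2`) resp. `2` (`p = 2`) off a null set, so that
`M_p(V,F) = (1 − p⁻²)·c_p·M_p(U₁,F)` (companion file, granted `brumerKramer_card_quotient_two`).
[cite: BhargavaShankarAnnals2015, Prop. 5.12 (definition of M_p(V,F); arXiv:1006.1002v2 numbering)] -/
def localMassV (p : ℕ) [Fact p.Prime] : ℝ :=
  (1 - 1 / (p : ℝ) ^ 2) * ∫ IJ in invariantPairsAdicClosure p, localSelmerRatio p IJ

/-- **The local mass `M_p(U₁,F)`** (Bhargava–Shankar, eq. (28)): "the measure of `F_p^{inv}` with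
respect to the measure `dI dJ` on `ℤ_p × ℤ_p` … normalized so that `ℤ_p × ℤ_p` has measure `1`.
That is, `M_p(U₁,F) = ∫_{(I,J) ∈ F_p^{inv}} dI dJ`", for the family of all elliptic curves
(`= |3⁴|_p (1 − p⁻¹⁰)`, companion file; the factors `∏_p (1 − p⁻¹⁰)` of `heightFamilyConstant`).
[cite: BhargavaShankarAnnals2015, eq. (28) (M_p(U_1,F); arXiv:1006.1002v2 numbering)] -/
def localMassU (p : ℕ) [Fact p.Prime] : ℝ :=
  (volume (invariantPairsAdicClosure p)).toReal

/-! ### `N(S^F; Y)` and the sieve step (†) of eq. (31) -/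

/-- `N(S^F; Y)`: "the number of `PGL₂(ℚ)`-equivalence classes of locally soluble irreducible
integral binary quartic forms having invariants `2⁴I` and `2⁶J`, such that `(I,J) ∈ F^{inv}` and
`H(2⁴I, 2⁶J) < Y`" (Bhargava–Shankar, held arXiv text §5.4, p. 34, there with `Y = 2¹²X`), for
the family of all elliptic curves; classes counted by `pgl2QClassCount`, `H(f) = H(I(f), J(f))`.
[cite: BhargavaShankarAnnals2015, §5.4 p. 34 (N(S^F; 2¹²X); arXiv:1006.1002v2 numbering)] -/
def locSolIrredClassCount (Y : ℝ) : ℕ :=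
  pgl2QClassCount {f : BinaryQuartic ℤ | f.IsLocallySoluble ∧ f.IsIrreducible ∧
    (∃ IJ ∈ invariantPairs, f.I = 2 ^ 4 * IJ.1 ∧ f.J = 2 ^ 6 * IJ.2) ∧ f.height < Y}

/-- **Bhargava–Shankar, the sieve step of eq. (31)** (held arXiv text §5.4, proof of Thm 5.14,
p. 34, second line of the display, for the family `F` of all elliptic curves): "By Propositions
5.12 and 5.13 we have, up to an error of `o(X^{5/6})`, that
`N(S^F; 2¹²X) = N(V_ℤ^{(0)} ∪ V_ℤ^{(2+)} ∪ V_ℤ^{(1)}; 2¹²X) · ∏_p μ_p(S^F)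
 = N(V_ℤ^{(0)} ∪ V_ℤ^{(2+)} ∪ V_ℤ^{(1)}; 2¹²X) · ∏_p |2¹⁰/3³|_p · M_p(V,F)` … the proof is again
identical to that of Theorem (mcc)" (the sieve of §3.7 on top of Thm 2.11, with the densities
`μ_p(S^F) = |2¹⁰/3³|_p M_p(V,F)` of Prop. 5.12 and the uniformity estimate Prop. 5.13). Here
`N(S^F; ·) = locSolIrredClassCount`, `N(V_ℤ^{(0)} ∪ V_ℤ^{(2+)} ∪ V_ℤ^{(1)}; ·)` is the number of
`GL₂(ℤ)`-classes of irreducible integral forms of height `< ·` that have four real roots, or are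
positive definite, or have two real roots (`gl2zClassCount`, Thm 2.1), `|·|_p = padicNorm p`, and
`M_p(V,F) = localMassV p`. Rendered: `[N(S^F;2¹²X) − N(V…;2¹²X)·∏_p |2¹⁰/3³|_p M_p(V,F)] / X^{5/6}
→ 0` as `X → ∞`. Together with Thm 2.1 (`bhargavaShankar_classCount`), Lemma 5.16
(`brumerKramer_card_quotient_two`) and Lemma 5.15 this yields eq. (31)
(`bhargavaShankar_sum_irredClassCount_asymptotic`) — companion `Proofs` files.
[cite: BhargavaShankarAnnals2015, §5.4 eq. (31), second line, with Props. 5.12–5.13 (arXiv:1006.1002v2 numbering)] -/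
def bhargavaShankar_locSolIrredClassCount_asymptotic : Prop :=
  Tendsto (fun X : ℝ ↦
      ((locSolIrredClassCount (2 ^ 12 * X) : ℝ) -
          (gl2zClassCount (fourRealRoots ∪ posDefinite ∪ twoRealRoots) (2 ^ 12 * X) : ℝ) *
            ∏' p : Nat.Primes, ((padicNorm p (2 ^ 10 / 3 ^ 3) : ℚ) : ℝ) *
              @localMassV p ⟨p.2⟩) /
        X ^ (5 / 6 : ℝ))
    atTop (𝓝 0)

end Literature.NumberTheory.EllipticCurves

end
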